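import Summits.FinalStateConjecture.FinalStateConjecture.Theses.LogTimeThreeAnnuli
import Summits.FinalStateConjecture.FinalStateConjecture.Theses.ExactKerrEnds
import Summits.FinalStateConjecture.FinalStateConjecture.Theorems.LogTimeThreeAnnuliSubconvergentEraGenericStubOrientationGaugeAbsorption
import Summits.FinalStateConjecture.FinalStateConjecture.Theorems.LogTimeThreeAnnuliSubconvergentEraGenericOfCensoredOmegaLimit
import Summits.FinalStateConjecture.FinalStateConjecture.Theorems.LogTimeThreeAnnuliSubconvergentEraGenericAlongKerrEnds
import Summits.FinalStateConjecture.FinalStateConjecture.Theorems.LogTimeThreeAnnuliSubconvergentEraGenericOfSettledAllOrders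
import Summits.FinalStateConjecture.FinalStateConjecture.Theorems.LogTimeThreeAnnuliSubconvergentEraGenericAlongKerrEndsWindow
import Summits.FinalStateConjecture.FinalStateConjecture.Theorems.LogTimeThreeAnnuliSubconvergentEraGenericUpToTwoOfExactKerrEndsItems
import Literature.Geometry.Lorentzian.TameGenericityDiagonal
import Literature.Geometry.Lorentzian.ExactKerrEnd
import Literature.Geometry.Lorentzian.TameGenericityLocalWindowImmersed
import HarnessLib

/-!
# Birth skeleton — crux stmt-FinalStateConjecture-17490 `Theses.LogTimeThreeAnnuli.SubconvergentEraGeneric` (IMPORT crux, rank 5)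
# line `birth` / `registered` — RESHAPED by lead c3 (2026-08-17), re-owned by leads c4/c5, RESHAPED AGAIN (window form of the residual) by lead c6, re-owned by lead c7, RESHAPED A THIRD TIME by lead prover-line-stmt-FinalStateConjecture-17490-c8-0 (2026-08-17, cycle 8: the third `ExactKerrEnds` item C₂ = stmt-18520 becomes a stub by name and the residual shrinks to the UPGRADE statement C₃, §UPGRADE)

The crux: for every connected Hausdorff second-countable smooth `3`-manifold `X`, the property
`P D` := "every MGHD of `D` has complete `𝓘⁺` AND carries an honest subconvergent final era (reference `N`-hole chart
geometry `d : QuasiFinalStateDecomposition 𝒟 O 2 ⊤`, `O = exteriorOf charted`, `RaysStayInClosure O`, honest radii,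
causal exhaustion, orthochronous motions, `(M,a)`-uniform COVECTOR chart-time orientation, flat `∂₀` future-directed,
flat zone `→ η` in every `Cᵏ`, near zones eventually `ε`-close in every `Cᵏ` on fixed and growing slabs to SOME member
of the window `m₀ ≤ M ≤ 1/m₀`, `|a| ≤ χM`)" is TAME Christodoulou-generic of codimension `≥ 1` in `admissibleVacuumData X`.

## History of the line
* birth (planner-skel, 02:41Z): K (`stub_censoredOmegaLimitGeneric` = tame-generic(P in the producers' VECTOR orientation
  gauge), the import) + G (`stub_orientationGaugeAbsorption`, pointwise vector → covector adapter) → crux by monotonicity of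
  `IsTameChristodoulouGeneric` in the property.
* lead c1: G landed (p145622); lead c2: `crux ⇐ K` landed (p150909), `crux + MGHDExists ⇒ WeakCosmicCensorshipTame` landed
  (p150808), K honesty audit (Cruxes/SubconvergentEraGeneric/K_HONESTY_AUDIT.md): K = the crux re-gauged ⊇ tame WCC + tame
  censored ω-limit + (∀k-vs-o₂ tails) a parametric far-annulus gluing escape; no producer among the 35 tame-generic items at
  07:30Z ⇒ `promote-stub K` (c0, c1, c2 concordant).

* lead c3: RESHAPE below (K ⇝ E + C₁ + C₂'); Literature `isTameChristodoulouGeneric_of_relative_exceptional` landed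
  (p153936); composition / converse / iff BY NAME landed (p154553,
  `Theorems/LogTimeThreeAnnuliSubconvergentEraGenericAlongKerrEnds.lean`); wave: E stub-blocked stmt-18522, C₁ stub-blocked
  stmt-18521; outcome `promote-stub C₂'`.
* lead c4: the composition `SubconvergentEraGeneric_of` is now the landed p154553 theorem by name (the local
  copy of `relative_exceptional` is dropped in favour of the Literature lemma); C₂' held by the lead; E, C₁ stay stub-blocked
  on their items (active seats there); added below the landed records: the POINTWISE adapter "settled in the Statement's
  vocabulary at all orders ⇒ the crux's era" and the record `C₂^∞ → C₂'` (C₂^∞ = all-orders settling along censored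
  Kerr-ended curves, the all-orders twin of `ExactKerrEnds.SettlingAlongCensoredKerrEnds`, stmt-18520) — see §ADAPTER;
  second pass: `era_upTo_of_settled` (kernel content of the finite-order repair C′(K₀)) and the merged seam
  `E → C₁ → C₂^∞ → MGHDExists → FinalStateConjecture` (p156598).  Outcome `promote-stub C₂'`.
* lead c5 (this revision; skeleton UNCHANGED — stubs, signatures and composition byte-identical to c4's): turn-boundary
  checks negative (siblings 18520/18521/18522 open, no new producer among the 59 Theses, no Disproof.lean); landed the
  ANTI-VACUITY OF THE EXISTENTIAL SIDE at a certified MGHD fibre —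
  `Theorems/LogTimeThreeAnnuliSubconvergentEraGenericTrivialDatum.lean` (p164172, registered sub-goal
  `subconvergentEraProperty_trivialData`): for EVERY maximal vacuum Cauchy development of the trivial datum `(ℝ³, δ, 0)`,
  complete `𝓘⁺` ∧ the crux's era verbatim (all orders, covector gauge), UNCONDITIONALLY (isometry to Minkowski space,
  transport of the honest `N = 0` decomposition, zero flat deviation at every order, `era_of_settledAllOrders`); hence
  `trivialData_not_exceptional`, and any refutation of the crux / of C₂' needs a non-flat admissible datum with a certified
  MGHD.  (Not imported here: a freshly landed module is not yet built on the check farm; it is a record, not a stub.)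
  Memo: Cruxes/SubconvergentEraGeneric/LINE-STATE-c5.md.  Outcome `promote-stub C₂'` stands.
* lead c6: turn-boundary checks negative again (siblings 18520/18521/18522 open; route LogTimeThreeAnnuli still
  rev 5, none of LINE-STATE-c4/c5's options A/B/C enacted; Theses unchanged except `ExactKerrEnds` 13:32Z /
  `EIHFluxBalance` 13:19Z, no new tame-generic producer; no Disproof.lean).  RESHAPE OF THE RESIDUAL TO ITS WEAKEST
  WITNESS FORM (§WINDOW below): C₂' ⇝ C₂ʷ = `stub_subconvergentEraAlongCensoredKerrEndsWindow` — the incoming curve is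
  GENUINE (immersed at `0` and injective; the constant alternative is never needed, because E ∧ C₁ already put a genuine
  censored Kerr-ended curve through EVERY admissible datum, `exists_censoredKerrEndedCurve`), and the producer delivers
  only an end, a window `ε > 0` and a tame curve immersed at `0` through the base datum whose members with `‖c‖ < ε` are
  admissible and with `0 < ‖c‖ < ε` satisfy `P` — no injectivity, nothing outside the window
  (`Literature.….isTameChristodoulouGeneric_one_of_localWindow`: injectivity is free for immersed curves, window control
  is upgraded by radial reparametrisation).  Landed as `Theorems/LogTimeThreeAnnuliSubconvergentEraGenericAlongKerrEndsWindow.lean`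
  (p166919, registered sub-goals `exists_censoredKerrEndedCurve`, `subconvergentEraGeneric_of_alongCensoredKerrEndsWindow`,
  `alongCensoredKerrEndsWindow_of_subconvergentEraGeneric`; also `C₂' → C₂ʷ` and the iff modulo E, C₁).  The composition
  below is the same proof INLINED (a freshly landed module is not yet built on the check farm).  Physics content of the
  residual unchanged (crux ⇔ C₂ʷ ⇔ C₂' modulo E, C₁); presearch (corpus + galaxy) recorded in Cruxes/…/LINE-STATE-c6.md —
  nearest prior art `paper:arxiv-2606.28253` (Hintz 2026, nonlinear stability of the full subextremal Kerr family:
  openness of settling near exact Kerr data, not density at exceptional large data).  Outcome `promote-stub C₂ʷ`.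
* lead c7 (this revision): turn-boundary checks negative again (siblings 18520/18521/18522 open; route LogTimeThreeAnnuli
  still rev 5, options A/B/C not enacted; Theses changed since c6: `KillingDefectSpacetimeBound` 17:37Z, `BondiDrainDispersal`
  16:55Z — both conclude the Statement's `C²` settled clause, neither produces the all-orders era or C₂^∞; no Disproof.lean;
  Negatives: `CountableGlueFails` only).  Skeleton: stubs BYTE-IDENTICAL to c6's registration; the composition and the records
  now IMPORT the landed `Theorems/LogTimeThreeAnnuliSubconvergentEraGenericAlongKerrEndsWindow.lean` (p166919 + p167205, built on
  the farm) instead of c6's inlined copy.  New kernel record this cycle (separate `--supports` file, see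
  Cruxes/…/LINE-STATE-c7.md): the OPTION C DOOR — the crux restated at finite order `K₀ = 2` follows from THREE EXISTING items by
  name, E (18522), C₁ (18521) and `Theses.ExactKerrEnds.SettlingAlongCensoredKerrEnds` (18520), through
  `exists_censoredKerrEndedCurve` and c4's pointwise `era_upTo_of_settled`.  Outcome: see LINE-STATE-c7.md.

## RESHAPE (lead c3): K ⇝ {E, C₁, C₂'} by COMPOSITION ALONG CURVES
After c2's scan the tree acquired exactly the pieces c2 §5 asked for: route `ExactKerrEnds` (Theses 09:47Z) with
`TameEscapeToKerrEnds` (stmt-FinalStateConjecture-18522: Kerr-endedness is tame-generic — the receding Corvino–Schoen gluing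
escape) and `CensorshipAlongKerrEnds` (stmt-FinalStateConjecture-18521: censorship produced ALONG Kerr-ended tame curves), the
Literature notion `InitialDataSet.HasExactKerrEnd` (`hasExactKerrEnd_iff`: verbatim the routes' let-bound legend, `Iff.rfl`) and
the Literature bookkeeping `InitialDataSet.isTameChristodoulouGeneric_of_relative'` (tame genericities compose along curves:
generic(Q) + "P-curves handed back along Q-curves" ⇒ generic(P); genericity is NOT ∧-closed, so this relative form is the
only door through which a generic hypothesis enters a generic conclusion).  The single crux-sized stub K is therefore
reshaped into THREE registered stubs with the SAME composition idea (transport of tame genericity — along curves instead of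
pointwise):
* `stub_tameEscapeToKerrEnds` (E) := `Theses.ExactKerrEnds.TameEscapeToKerrEnds` BY NAME (item 18522, size L, that route's
  line `Cruxes/TameEscapeToKerrEnds`).  Imported, not re-proved here: when `TameEscapeToKerrEnds_holds` lands it discharges
  this stub by `exact`.
* `stub_censorshipAlongKerrEnds` (C₁) := `Theses.ExactKerrEnds.CensorshipAlongKerrEnds` BY NAME (item 18521, open problem =
  weak cosmic censorship in positive tame codimension inside the Kerr-ended class, relative form; that route's line
  `Cruxes/CensorshipAlongKerrEnds`, with a standing Disproof.lean).
* `stub_subconvergentEraAlongCensoredKerrEnds` (C₂', the RESIDUAL, new): for every end `e` and tame curve `F` of admissible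
  data on `e`, immersed-injective or constant, whose members off `0` are Kerr-ended (`HasExactKerrEnd`) AND censored, and
  whose base datum `F 0` is EXCEPTIONAL for `P` (¬ P (F 0)), there are an end `e'` and a tame injective immersed curve `F'`
  of admissible data, `F' 0 = F 0`, whose members off `0` satisfy `P` (complete `𝓘⁺` ∧ the crux's era, covector gauge,
  verbatim; window background as the anonymous constructor `⟨domain, boostedKerrBilin …, time, radius⟩`, definitionally the
  crux's `{d.background i with bilin := …}`, registrar-safe).  Why plausibly true: it is the ω-limit / capture content of
  the final state conjecture for compactly supported deviations from EXACT KERR ENDS (exact Kerr far development, so the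
  far-field focusing obstruction of c2 §5 / Negative/FarFieldFocusing is void and `∀ k` costs nothing at `i⁰`), asked only
  through exceptional base data (no stability demand at good data) and only in SUBCONVERGENT form (the member may wander —
  this route's DyadicCapture/DyadicSummability do the rest).  Why it might fail: an open set of censored Kerr-ended data with
  a non-Kerr ω-limit / eternal binary / tame-stable extremal remnant; loss of uniformity as the Kerr end recedes (`R(c) → ∞`);
  clause C (rays off closure O) on some topology.  Size: open-problem (import; the would-be producer is an "ω-limit along
  censored Kerr ends" item — `ExactKerrEnds.SettlingAlongCensoredKerrEnds` (18520) is its CONVERGENT C² cousin, neither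
  implies the other as typed).
K ⇒ C₂' (via G, pointwise) and K ⇒ crux (p150909) remain true; C₂' is strictly weaker than K (no claim off Kerr-ended
censored curves, none at good base data).  G (landed) is no longer on the composition path: C₂' is stated in the crux's own
covector gauge (weaker for an import, by G); a vector-gauge producer converts with
`Theorems.…SubconvergentEraGeneric.stub_orientationGaugeAbsorption`.

Composition `SubconvergentEraGeneric_of : E → C₁ → C₂' → SubconvergentEraGeneric`: every admissible datum has a sole DR end
(`exists_isSoleEnd_of_mem_admissibleVacuumData`, so constant curves are tame); `relative' (E, C₁)` gives tame genericity of
"Kerr-ended ∧ censored"; `isTameChristodoulouGeneric_of_relative_exceptional` (proved below: `relative'` whose hand-back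
hypothesis is only asked at base data exceptional for `P` — the composition never uses it elsewhere) with C₂' gives the crux
BY NAME.  Disproof.lean: none for this crux.  Dead lines: none.  Negatives: `Theorems/SubconvergentEraGeneric/Negative/
CountableGlueFails.lean` (∀k-indexed producers cannot be glued — not used: no k-indexed stub here).

## ADAPTER (lead c4): `Theorems/LogTimeThreeAnnuliSubconvergentEraGenericOfSettledAllOrders.lean` (p156598)
Pointwise `era_of_settledAllOrders`: a `FinalStateDecomposition 𝒟 O 2` with sub-extremal holes, `O = exteriorOf charted`,
`RaysStayInClosure`, `IsFutureOriented`, honest exhaustive radii and convergence in the same charts at every order yields the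
crux's era verbatim (order-by-order: clause `k` uses order `k`, orientation uses order `0`).  Hence `C₂^∞ → C₂'`
(`Sig.settlingAllOrdersAlongCensoredKerrEnds`, records at the end) and 17490 ⇐ {18522, 18521, C₂^∞}: the residual import is
fed by ONE settling statement in the Statement's own vocabulary at all orders — the all-orders twin of ExactKerrEnds'
stmt-18520.  C₂' stays THE registered residual (weakest: crux ⇒ C₂'); C₂^∞ is strictly stronger (convergent) and is recorded,
not registered as a stub.

## WINDOW (lead c6): the residual in the weakest witness form
`SubconvergentEraGeneric_of : E → C₁ → C₂ʷ → SubconvergentEraGeneric`: at an admissible datum `d` exceptional for `P`,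
`exists_censoredKerrEndedCurve` (E, C₁ pointed: Kerr-ended `d` ↦ C₁ on the constant curve on the sole DR end of `d`;
otherwise C₁ on E's escape curve) gives a tame, injective, immersed curve of admissible data through `d` with Kerr-ended
censored members off `0`; C₂ʷ hands back a window-controlled `P`-curve through `d`; `isTameChristodoulouGeneric_one_of_localWindow`
concludes the route decl BY NAME.  Records: `crux → C₂ʷ` (necessity, so C₂ʷ is not junk-stronger), `C₂' → C₂ʷ`,
`K_ret → C₂ʷ`, `C₂^∞ → C₂ʷ`, and the iff modulo E, C₁.
* lead c8 (this revision): turn-boundary checks negative again (siblings 18520/18521/18522 open and unclaimed at 18:46Z; route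
  LogTimeThreeAnnuli still rev 5, options A/B/C not enacted; no Disproof.lean; Negatives: `CountableGlueFails` only; new in the
  tree since c7: the DyadicCapture lead's `Theorems/LogTimeThreeAnnuliDyadicCaptureNecessity.lean` (Statement CONCL ⇒ order-2
  era pointwise, 18:42Z) and `…DyadicCaptureOrderTwo.lean` — 17488 is being worked AT ORDER TWO).  RESHAPE (§UPGRADE): the third
  `ExactKerrEnds` item C₂ = `Theses.ExactKerrEnds.SettlingAlongCensoredKerrEnds` (stmt-18520) joins E and C₁ as a stub BY NAME, and
  the residual C₂ʷ is replaced by the UPGRADE residual C₃ = `stub_subconvergentEraAlongSettledWindow` (all-orders era, window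
  form, along SETTLED tame curves through exceptional base data); `C₂ ∧ C₃ → C₂ʷ`, `crux → C₃` (so modulo E, C₁, C₂ the crux IS
  C₃), and C₃ CUT AT ORDER 2 IS PROVED OUTRIGHT (`alongSettledWindowUpToTwo`, `F' = F`) — the content of the crux beyond the three
  existing items is exactly the orders `k ≥ 3` of the two convergence clauses.  Also recorded: the NECESSITY door
  `FinalStateConjecture → crux≤₂`.  All of it landed as `Theorems/LogTimeThreeAnnuliSubconvergentEraGenericAlongSettledWindow.lean`
  (--supports 17490); the composition below is the same proof INLINED (a freshly landed module is not yet built on the farm).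
  wave: none — E, C₁, C₂ are seated items (18522 / 18521 / 18520, each with its own line lead); C₃ is the lead's.

## UPGRADE (lead c8): the residual relative to ALL THREE `ExactKerrEnds` items
`SubconvergentEraGeneric_of : E → C₁ → C₂ → C₃ → SubconvergentEraGeneric`: at an admissible datum `d` exceptional for `P`,
`exists_censoredKerrEndedCurve` (E ∧ C₁ pointed, p166919) gives a tame, injective, immersed curve of admissible data through `d`
with Kerr-ended censored members off `0`; C₂ (immersed-injective branch; its let-bound legends are `HasExactKerrEnd` / complete
`𝓘⁺` verbatim) returns a tame injective immersed admissible curve through `d` whose members off `0` satisfy the Statement's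
settled clause (`C²` final state decomposition with sub-extremal holes, `O = exteriorOf charted`, `RaysStayInClosure`,
`HasExhaustiveCharts`, `IsFutureOriented`, complete `𝓘⁺`); C₃ turns THAT curve into a window-controlled `P`-curve through `d`;
`isTameChristodoulouGeneric_one_of_localWindow` concludes the route decl BY NAME.  Why C₃ is the right residual: (i) it is
NECESSARY (`crux → C₃` unconditionally, through the bare window form p167205), so not junk-stronger; (ii) modulo the three
existing items it is EQUIVALENT to the crux; (iii) its order-`2` cut is a THEOREM (`alongSettledWindowUpToTwo`: the settled
member itself carries the cut era, `subconvergentEraUpToTwo_of_settled`), so what it imports is precisely the higher-order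
(`k ≥ 3`) flat-zone and near-zone convergence along tame curves through exceptional data, from `C²`-settled raw material —
a regularity / re-gluing upgrade, perturbative about settled developments — and no longer the large-data settling problem
(= C₂) that C₂ʷ still contained.  Why it might fail: only together with the crux (necessity); mechanism-wise, rough admissible
tails (`o₂` class) settle in `C²` yet focus at order `3` (K_HONESTY_AUDIT §5: `t^{4b−3−a}` at the focal worldline), so `F' = F`
is unavailable and a producer must re-glue the members' far ends to exact Kerr (receding, tame-legal) and re-settle them at all
orders — Kerr-stability-type input for the full sub-extremal range (Hintz 2026 arXiv:2606.28253 nearest; DHRT 2021 for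
`|a| ≪ M`; Klainerman–Szeftel 2023).  Size: open-problem (import), but strictly inside C₂ʷ.

-/

set_option linter.dupNamespace false

noncomputable section

open scoped Manifold ContDiff Topology ENNReal
open Filter Set Function Literature.Geometry.Lorentzian
open Summit.FinalStateConjecture (HasCompleteNullInfinity exteriorOf RaysStayInClosure IsOrthochronous HasExhaustiveCharts
  IsFutureOriented)
open Literature.Geometry.Lorentzian.InitialDataSet (IsTameDataFamily IsImmersedAtZero IsTameChristodoulouGeneric)

namespace Summit.FinalStateConjecture.FinalStateConjecture.Cruxes.SubconvergentEraGeneric.Birth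

open Summit.FinalStateConjecture.FinalStateConjecture.Theses.LogTimeThreeAnnuli (SubconvergentEraGeneric)

/-! ## Legend: the stub statements as named propositions (verbatim the registered signatures) -/

/-- Statement of `stub_tameEscapeToKerrEnds` (E): item stmt-FinalStateConjecture-18522 by name. -/
def Sig.stub_tameEscapeToKerrEnds : Prop :=
  Summit.FinalStateConjecture.FinalStateConjecture.Theses.ExactKerrEnds.TameEscapeToKerrEnds

/-- Statement of `stub_censorshipAlongKerrEnds` (C₁): item stmt-FinalStateConjecture-18521 by name. -/
def Sig.stub_censorshipAlongKerrEnds : Prop :=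
  Summit.FinalStateConjecture.FinalStateConjecture.Theses.ExactKerrEnds.CensorshipAlongKerrEnds

/-- Statement of the RETIRED residual C₂' (`stub_subconvergentEraAlongCensoredKerrEnds`, leads c3–c5): kept for the
records `C₂' → C₂ʷ`, `K_ret → C₂'  → C₂ʷ`, `C₂^∞ → C₂' → C₂ʷ`. -/
def Sig.stub_subconvergentEraAlongCensoredKerrEnds_retired : Prop :=
  ∀ (X : Type) [TopologicalSpace X] [ChartedSpace E3 X] [IsManifold (𝓡 3) ∞ X] [T2Space X] [SecondCountableTopology X] [ConnectedSpace X], ∀ (e : AFEnd X) (F : EuclideanSpace ℝ (Fin 1) → InitialDataSet (𝓡 3) X), IsTameDataFamily e 1 F → ((IsImmersedAtZero 1 F ∧ Injective F) ∨ ∀ c, F c = F 0) → (∀ c, F c ∈ admissibleVacuumData X) → (∀ c ≠ 0, (F c).HasExactKerrEnd ∧ ∀ 𝒟 : VacuumCauchyDevelopment (F c), 𝒟.IsMaximal → HasCompleteNullInfinity 𝒟.toCauchyDevelopment) → ¬ (∀ 𝒟 : VacuumCauchyDevelopment (F 0), 𝒟.IsMaximal → HasCompleteNullInfinity 𝒟.toCauchyDevelopment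 ∧ (∃ (m₀ χ : ℝ) (O : Set 𝒟.carrier) (d : QuasiFinalStateDecomposition 𝒟.toSpacetime O 2 ⊤) (R : Fin d.N → ℝ → ℝ), 0 < m₀ ∧ χ < 1 ∧ O = exteriorOf 𝒟.toCauchyDevelopment d.charted ∧ RaysStayInClosure 𝒟.toCauchyDevelopment O ∧ (∀ i, Tendsto (R i) atTop atTop ∧ ∀ τ, max (Kerr.rPlus (d.mass i) (d.spin i)) 0 + 1 ≤ R i τ) ∧ (∀ τ₁, d.τ₀ < τ₁ → O \ d.certifiedLate R τ₁ ⊆ 𝒟.metric.causalPast 𝒟.timeOrientation (d.certifiedSlab R τ₁)) ∧ (∀ i, IsOrthochronous (d.motion i).1) ∧ (∀ i (ρ : ℝ), ∀ᶠ τ in atTop, ∀ x ∈ (d.background i).truncTimeSlab ρ τ, ∀ w : E4, 𝒟.timeOrientation.IsFutureDirected (mfderiv 𝓘(ℝ, E4) (𝓡 4) (d.chart i) x w) → 0 < ((d.motion i).1 : E4 ≃L[ℝ] E4).symm w 0) ∧ (∀ᶠ τ in atTop, ∀ x ∈ (Minkowski.backgroundOn d.flatDomain).timeSlab τ, 𝒟.timeOrientation.IsFutureDirected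 (mfderiv 𝓘(ℝ, E4) (𝓡 4) d.flatChart x (E4.basisVector 0))) ∧ (∀ k, Tendsto (fun τ => 𝒟.toSpacetime.deviationCk (Minkowski.backgroundOn d.flatDomain) d.flatChart k τ) atTop (𝓝 0)) ∧ (∀ i k (ρ : ℝ) (ε : ℝ≥0∞), 0 < ε → ∀ᶠ τ in atTop, ∃ M a, m₀ ≤ M ∧ M ≤ m₀⁻¹ ∧ |a| ≤ χ * M ∧ 𝒟.toSpacetime.truncDeviationCk ⟨(d.background i).domain, boostedKerrBilin (d.motion i).1 (d.motion i).2 M a, (d.background i).time, (d.background i).radius⟩ (d.chart i) k ρ τ ≤ ε ∧ 𝒟.toSpacetime.truncDeviationCk ⟨(d.background i).domain, boostedKerrBilin (d.motion i).1 (d.motion i).2 M a, (d.background i).time, (d.background i).radius⟩ (d.chart i) k (R i τ) τ ≤ ε))) → ∃ (e' : AFEnd X) (F' : EuclideanSpace ℝ (Fin 1) → InitialDataSet (𝓡 3) X), IsTameDataFamily e' 1 F' ∧ F' 0 = F 0 ∧ Injective F' ∧ IsImmersedAtZero 1 F' ∧ (∀ c, F' c ∈ admissibleVacuumData X) ∧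 ∀ c ≠ 0, ∀ 𝒟 : VacuumCauchyDevelopment (F' c), 𝒟.IsMaximal → HasCompleteNullInfinity 𝒟.toCauchyDevelopment ∧ (∃ (m₀ χ : ℝ) (O : Set 𝒟.carrier) (d : QuasiFinalStateDecomposition 𝒟.toSpacetime O 2 ⊤) (R : Fin d.N → ℝ → ℝ), 0 < m₀ ∧ χ < 1 ∧ O = exteriorOf 𝒟.toCauchyDevelopment d.charted ∧ RaysStayInClosure 𝒟.toCauchyDevelopment O ∧ (∀ i, Tendsto (R i) atTop atTop ∧ ∀ τ, max (Kerr.rPlus (d.mass i) (d.spin i)) 0 + 1 ≤ R i τ) ∧ (∀ τ₁, d.τ₀ < τ₁ → O \ d.certifiedLate R τ₁ ⊆ 𝒟.metric.causalPast 𝒟.timeOrientation (d.certifiedSlab R τ₁)) ∧ (∀ i, IsOrthochronous (d.motion i).1) ∧ (∀ i (ρ : ℝ), ∀ᶠ τ in atTop, ∀ x ∈ (d.background i).truncTimeSlab ρ τ, ∀ w : E4, 𝒟.timeOrientation.IsFutureDirected (mfderiv 𝓘(ℝ, E4) (𝓡 4) (d.chart i) x w) → 0 < ((d.motion i).1 :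 E4 ≃L[ℝ] E4).symm w 0) ∧ (∀ᶠ τ in atTop, ∀ x ∈ (Minkowski.backgroundOn d.flatDomain).timeSlab τ, 𝒟.timeOrientation.IsFutureDirected (mfderiv 𝓘(ℝ, E4) (𝓡 4) d.flatChart x (E4.basisVector 0))) ∧ (∀ k, Tendsto (fun τ => 𝒟.toSpacetime.deviationCk (Minkowski.backgroundOn d.flatDomain) d.flatChart k τ) atTop (𝓝 0)) ∧ (∀ i k (ρ : ℝ) (ε : ℝ≥0∞), 0 < ε → ∀ᶠ τ in atTop, ∃ M a, m₀ ≤ M ∧ M ≤ m₀⁻¹ ∧ |a| ≤ χ * M ∧ 𝒟.toSpacetime.truncDeviationCk ⟨(d.background i).domain, boostedKerrBilin (d.motion i).1 (d.motion i).2 M a, (d.background i).time, (d.background i).radius⟩ (d.chart i) k ρ τ ≤ ε ∧ 𝒟.toSpacetime.truncDeviationCk ⟨(d.background i).domain, boostedKerrBilin (d.motion i).1 (d.motion i).2 M a, (d.background i).time, (d.background i).radius⟩ (d.chart i) k (R i τ) τ ≤ ε))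

/-- Statement of C₂ʷ (`stub_subconvergentEraAlongCensoredKerrEndsWindow`, the residual of leads c6–c7, RETIRED AS A STUB by
lead c8 and kept for the records `C₂ ∧ C₃ → C₂ʷ`, `crux → C₂ʷ`, `C₂' / K_ret / C₂^∞ → C₂ʷ`): the crux's property produced,
WINDOW-CONTROLLED, along genuine censored Kerr-ended tame curves through exceptional base data. -/
def Sig.stub_subconvergentEraAlongCensoredKerrEndsWindow : Prop :=
  ∀ (X : Type) [TopologicalSpace X] [ChartedSpace E3 X] [IsManifold (𝓡 3) ∞ X] [T2Space X] [SecondCountableTopology X] [ConnectedSpace X], ∀ (e : AFEnd X) (F : EuclideanSpace ℝ (Fin 1) → InitialDataSet (𝓡 3) X), IsTameDataFamily e 1 F → IsImmersedAtZero 1 F → Injective F → (∀ c, F c ∈ admissibleVacuumData X) → (∀ c ≠ 0, (F c).HasExactKerrEnd ∧ ∀ 𝒟 : VacuumCauchyDevelopment (F c), 𝒟.IsMaximal → HasCompleteNullInfinity 𝒟.toCauchyDevelopment) → ¬ (∀ 𝒟 : VacuumCauchyDevelopment (F 0), 𝒟.IsMaximal → HasCompleteNullInfinity 𝒟.toCauchyDevelopment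 ∧ (∃ (m₀ χ : ℝ) (O : Set 𝒟.carrier) (d : QuasiFinalStateDecomposition 𝒟.toSpacetime O 2 ⊤) (R : Fin d.N → ℝ → ℝ), 0 < m₀ ∧ χ < 1 ∧ O = exteriorOf 𝒟.toCauchyDevelopment d.charted ∧ RaysStayInClosure 𝒟.toCauchyDevelopment O ∧ (∀ i, Tendsto (R i) atTop atTop ∧ ∀ τ, max (Kerr.rPlus (d.mass i) (d.spin i)) 0 + 1 ≤ R i τ) ∧ (∀ τ₁, d.τ₀ < τ₁ → O \ d.certifiedLate R τ₁ ⊆ 𝒟.metric.causalPast 𝒟.timeOrientation (d.certifiedSlab R τ₁)) ∧ (∀ i, IsOrthochronous (d.motion i).1) ∧ (∀ i (ρ : ℝ), ∀ᶠ τ in atTop, ∀ x ∈ (d.background i).truncTimeSlab ρ τ, ∀ w : E4, 𝒟.timeOrientation.IsFutureDirected (mfderiv 𝓘(ℝ, E4) (𝓡 4) (d.chart i) x w) → 0 < ((d.motion i).1 : E4 ≃L[ℝ] E4).symm w 0) ∧ (∀ᶠ τ in atTop, ∀ x ∈ (Minkowski.backgroundOn d.flatDomain).timeSlab τ, 𝒟.timeOrientation.IsFutureDirected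 (mfderiv 𝓘(ℝ, E4) (𝓡 4) d.flatChart x (E4.basisVector 0))) ∧ (∀ k, Tendsto (fun τ => 𝒟.toSpacetime.deviationCk (Minkowski.backgroundOn d.flatDomain) d.flatChart k τ) atTop (𝓝 0)) ∧ (∀ i k (ρ : ℝ) (ε : ℝ≥0∞), 0 < ε → ∀ᶠ τ in atTop, ∃ M a, m₀ ≤ M ∧ M ≤ m₀⁻¹ ∧ |a| ≤ χ * M ∧ 𝒟.toSpacetime.truncDeviationCk ⟨(d.background i).domain, boostedKerrBilin (d.motion i).1 (d.motion i).2 M a, (d.background i).time, (d.background i).radius⟩ (d.chart i) k ρ τ ≤ ε ∧ 𝒟.toSpacetime.truncDeviationCk ⟨(d.background i).domain, boostedKerrBilin (d.motion i).1 (d.motion i).2 M a, (d.background i).time, (d.background i).radius⟩ (d.chart i) k (R i τ) τ ≤ ε))) → ∃ (e' : AFEnd X) (ε : ℝ) (F' : EuclideanSpace ℝ (Fin 1) → InitialDataSet (𝓡 3) X), 0 < ε ∧ IsTameDataFamily e' 1 F' ∧ IsImmersedAtZero 1 F' ∧ F' 0 = F 0 ∧ (∀ c, ‖c‖ < ε →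 F' c ∈ admissibleVacuumData X) ∧ ∀ c, c ≠ 0 → ‖c‖ < ε → ∀ 𝒟 : VacuumCauchyDevelopment (F' c), 𝒟.IsMaximal → HasCompleteNullInfinity 𝒟.toCauchyDevelopment ∧ (∃ (m₀ χ : ℝ) (O : Set 𝒟.carrier) (d : QuasiFinalStateDecomposition 𝒟.toSpacetime O 2 ⊤) (R : Fin d.N → ℝ → ℝ), 0 < m₀ ∧ χ < 1 ∧ O = exteriorOf 𝒟.toCauchyDevelopment d.charted ∧ RaysStayInClosure 𝒟.toCauchyDevelopment O ∧ (∀ i, Tendsto (R i) atTop atTop ∧ ∀ τ, max (Kerr.rPlus (d.mass i) (d.spin i)) 0 + 1 ≤ R i τ) ∧ (∀ τ₁, d.τ₀ < τ₁ → O \ d.certifiedLate R τ₁ ⊆ 𝒟.metric.causalPast 𝒟.timeOrientation (d.certifiedSlab R τ₁)) ∧ (∀ i, IsOrthochronous (d.motion i).1) ∧ (∀ i (ρ : ℝ), ∀ᶠ τ in atTop, ∀ x ∈ (d.background i).truncTimeSlab ρ τ, ∀ w : E4, 𝒟.timeOrientation.IsFutureDirected (mfderiv 𝓘(ℝ, E4)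 (𝓡 4) (d.chart i) x w) → 0 < ((d.motion i).1 : E4 ≃L[ℝ] E4).symm w 0) ∧ (∀ᶠ τ in atTop, ∀ x ∈ (Minkowski.backgroundOn d.flatDomain).timeSlab τ, 𝒟.timeOrientation.IsFutureDirected (mfderiv 𝓘(ℝ, E4) (𝓡 4) d.flatChart x (E4.basisVector 0))) ∧ (∀ k, Tendsto (fun τ => 𝒟.toSpacetime.deviationCk (Minkowski.backgroundOn d.flatDomain) d.flatChart k τ) atTop (𝓝 0)) ∧ (∀ i k (ρ : ℝ) (ε : ℝ≥0∞), 0 < ε → ∀ᶠ τ in atTop, ∃ M a, m₀ ≤ M ∧ M ≤ m₀⁻¹ ∧ |a| ≤ χ * M ∧ 𝒟.toSpacetime.truncDeviationCk ⟨(d.background i).domain, boostedKerrBilin (d.motion i).1 (d.motion i).2 M a, (d.background i).time, (d.background i).radius⟩ (d.chart i) k ρ τ ≤ ε ∧ 𝒟.toSpacetime.truncDeviationCk ⟨(d.background i).domain, boostedKerrBilin (d.motion i).1 (d.motion i).2 M a, (d.background i).time, (d.background i).radius⟩ (d.chart i) k (R i τ) τ ≤ ε))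

/-- Statement of `stub_settlingAlongCensoredKerrEnds` (C₂): item stmt-FinalStateConjecture-18520 by name. -/
def Sig.stub_settlingAlongCensoredKerrEnds : Prop :=
  Summit.FinalStateConjecture.FinalStateConjecture.Theses.ExactKerrEnds.SettlingAlongCensoredKerrEnds

/-- Statement of `stub_subconvergentEraAlongSettledWindow` (C₃, THE residual since lead c8): the crux's property produced,
WINDOW-CONTROLLED, along tame immersed injective curves of admissible data whose members off `0` are SETTLED in the Statement's
vocabulary, through exceptional base data (verbatim the registered signature; `Settled` legend of `Theses.ExactKerrEnds`). -/
def Sig.stub_subconvergentEraAlongSettledWindow : Prop :=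
  ∀ (X : Type) [TopologicalSpace X] [ChartedSpace E3 X] [IsManifold (𝓡 3) ∞ X] [T2Space X] [SecondCountableTopology X] [ConnectedSpace X], ∀ D, ¬ (∀ 𝒟 : VacuumCauchyDevelopment D, 𝒟.IsMaximal → HasCompleteNullInfinity 𝒟.toCauchyDevelopment ∧ (∃ (m₀ χ : ℝ) (O : Set 𝒟.carrier) (d : QuasiFinalStateDecomposition 𝒟.toSpacetime O 2 ⊤) (R : Fin d.N → ℝ → ℝ), 0 < m₀ ∧ χ < 1 ∧ O = exteriorOf 𝒟.toCauchyDevelopment d.charted ∧ RaysStayInClosure 𝒟.toCauchyDevelopment O ∧ (∀ i, Tendsto (R i) atTop atTop ∧ ∀ τ, max (Kerr.rPlus (d.mass i) (d.spin i)) 0 + 1 ≤ R i τ) ∧ (∀ τ₁, d.τ₀ < τ₁ → O \ d.certifiedLate R τ₁ ⊆ 𝒟.metric.causalPast 𝒟.timeOrientation (d.certifiedSlab R τ₁)) ∧ (∀ i, IsOrthochronous (d.motion i).1) ∧ (∀ i (ρ : ℝ), ∀ᶠ τ in atTop, ∀ x ∈ (d.background i).truncTimeSlab ρ τ, ∀ w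 : E4, 𝒟.timeOrientation.IsFutureDirected (mfderiv 𝓘(ℝ, E4) (𝓡 4) (d.chart i) x w) → 0 < ((d.motion i).1 : E4 ≃L[ℝ] E4).symm w 0) ∧ (∀ᶠ τ in atTop, ∀ x ∈ (Minkowski.backgroundOn d.flatDomain).timeSlab τ, 𝒟.timeOrientation.IsFutureDirected (mfderiv 𝓘(ℝ, E4) (𝓡 4) d.flatChart x (E4.basisVector 0))) ∧ (∀ k, Tendsto (fun τ => 𝒟.toSpacetime.deviationCk (Minkowski.backgroundOn d.flatDomain) d.flatChart k τ) atTop (𝓝 0)) ∧ (∀ i k (ρ : ℝ) (ε : ℝ≥0∞), 0 < ε → ∀ᶠ τ in atTop, ∃ M a, m₀ ≤ M ∧ M ≤ m₀⁻¹ ∧ |a| ≤ χ * M ∧ 𝒟.toSpacetime.truncDeviationCk ⟨(d.background i).domain, boostedKerrBilin (d.motion i).1 (d.motion i).2 M a, (d.background i).time, (d.background i).radius⟩ (d.chart i) k ρ τ ≤ ε ∧ 𝒟.toSpacetime.truncDeviationCk ⟨(d.background i).domain, boostedKerrBilin (d.motion i).1 (d.motion i).2 M a, (d.background i).time, (d.background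 i).radius⟩ (d.chart i) k (R i τ) τ ≤ ε))) → ∀ e F, IsTameDataFamily e 1 F → IsImmersedAtZero 1 F → Injective F → F 0 = D → (∀ c, F c ∈ admissibleVacuumData X) → (∀ c ≠ 0, ∀ 𝒟 : VacuumCauchyDevelopment (F c), 𝒟.IsMaximal → HasCompleteNullInfinity 𝒟.toCauchyDevelopment ∧ ∃ (O : _) (d : FinalStateDecomposition 𝒟.toSpacetime O 2), (∀ i, Kerr.IsSubextremal (d.mass i) (d.spin i)) ∧ O = exteriorOf 𝒟.toCauchyDevelopment d.charted ∧ RaysStayInClosure 𝒟.toCauchyDevelopment O ∧ HasExhaustiveCharts d ∧ IsFutureOriented d) → ∃ e' ε F', 0 < ε ∧ IsTameDataFamily e' 1 F' ∧ IsImmersedAtZero 1 F' ∧ F' 0 = D ∧ (∀ c, ‖c‖ < ε → F' c ∈ admissibleVacuumData X) ∧ ∀ c, c ≠ 0 → ‖c‖ < ε → ∀ 𝒟 : VacuumCauchyDevelopment (F' c), 𝒟.IsMaximal → HasCompleteNullInfinity 𝒟.toCauchyDevelopment ∧ (∃ (m₀ χ : ℝ) (O : Set 𝒟.carrier) (d :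 QuasiFinalStateDecomposition 𝒟.toSpacetime O 2 ⊤) (R : Fin d.N → ℝ → ℝ), 0 < m₀ ∧ χ < 1 ∧ O = exteriorOf 𝒟.toCauchyDevelopment d.charted ∧ RaysStayInClosure 𝒟.toCauchyDevelopment O ∧ (∀ i, Tendsto (R i) atTop atTop ∧ ∀ τ, max (Kerr.rPlus (d.mass i) (d.spin i)) 0 + 1 ≤ R i τ) ∧ (∀ τ₁, d.τ₀ < τ₁ → O \ d.certifiedLate R τ₁ ⊆ 𝒟.metric.causalPast 𝒟.timeOrientation (d.certifiedSlab R τ₁)) ∧ (∀ i, IsOrthochronous (d.motion i).1) ∧ (∀ i (ρ : ℝ), ∀ᶠ τ in atTop, ∀ x ∈ (d.background i).truncTimeSlab ρ τ, ∀ w : E4, 𝒟.timeOrientation.IsFutureDirected (mfderiv 𝓘(ℝ, E4) (𝓡 4) (d.chart i) x w) → 0 < ((d.motion i).1 : E4 ≃L[ℝ] E4).symm w 0) ∧ (∀ᶠ τ in atTop, ∀ x ∈ (Minkowski.backgroundOn d.flatDomain).timeSlab τ, 𝒟.timeOrientation.IsFutureDirected (mfderiv 𝓘(ℝ, E4) (𝓡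 4) d.flatChart x (E4.basisVector 0))) ∧ (∀ k, Tendsto (fun τ => 𝒟.toSpacetime.deviationCk (Minkowski.backgroundOn d.flatDomain) d.flatChart k τ) atTop (𝓝 0)) ∧ (∀ i k (ρ : ℝ) (ε : ℝ≥0∞), 0 < ε → ∀ᶠ τ in atTop, ∃ M a, m₀ ≤ M ∧ M ≤ m₀⁻¹ ∧ |a| ≤ χ * M ∧ 𝒟.toSpacetime.truncDeviationCk ⟨(d.background i).domain, boostedKerrBilin (d.motion i).1 (d.motion i).2 M a, (d.background i).time, (d.background i).radius⟩ (d.chart i) k ρ τ ≤ ε ∧ 𝒟.toSpacetime.truncDeviationCk ⟨(d.background i).domain, boostedKerrBilin (d.motion i).1 (d.motion i).2 M a, (d.background i).time, (d.background i).radius⟩ (d.chart i) k (R i τ) τ ≤ ε))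

/-- The retired stub K (`stub_censoredOmegaLimitGeneric`, vector gauge), kept as a named proposition for the record
(`K → crux` is the landed `Theorems.…subconvergentEraGeneric_of_censoredOmegaLimitGeneric`, p150909). -/
def Sig.stub_censoredOmegaLimitGeneric_retired : Prop :=
  open Literature.Geometry.Lorentzian in ∀ (X : Type) [TopologicalSpace X] [ChartedSpace E3 X] [IsManifold (𝓡 3) ((⊤ : ℕ∞) : WithTop ℕ∞) X] [T2Space X] [SecondCountableTopology X] [ConnectedSpace X], InitialDataSet.IsTameChristodoulouGeneric (admissibleVacuumData X) (fun D => ∀ 𝒟 : VacuumCauchyDevelopment D, 𝒟.IsMaximal → Summit.FinalStateConjecture.HasCompleteNullInfinity 𝒟.toCauchyDevelopment ∧ (∃ (m₀ χ : ℝ) (O : Set 𝒟.carrier) (d : QuasiFinalStateDecomposition 𝒟.toSpacetime O 2 ⊤) (R : Fin d.N → ℝ → ℝ), 0 < m₀ ∧ χ < 1 ∧ O = Summit.FinalStateConjecture.exteriorOf 𝒟.toCauchyDevelopment d.charted ∧ Summit.FinalStateConjecture.RaysStayInClosure 𝒟.toCauchyDevelopment O ∧ (∀ i : Fin d.N, Filter.Tendsto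 (R i) Filter.atTop Filter.atTop ∧ ∀ τ : ℝ, max (Kerr.rPlus (d.mass i) (d.spin i)) 0 + 1 ≤ R i τ) ∧ (∀ τ₁ : ℝ, d.τ₀ < τ₁ → O \ d.certifiedLate R τ₁ ⊆ 𝒟.metric.causalPast 𝒟.timeOrientation (d.certifiedSlab R τ₁)) ∧ (∀ i : Fin d.N, Summit.FinalStateConjecture.IsOrthochronous (d.motion i).1) ∧ (∀ᶠ τ in Filter.atTop, ∀ x ∈ (Minkowski.backgroundOn d.flatDomain).timeSlab τ, 𝒟.timeOrientation.IsFutureDirected (mfderiv 𝓘(ℝ, E4) (𝓡 4) d.flatChart x (E4.basisVector 0))) ∧ (∀ k : ℕ, Filter.Tendsto (fun τ => 𝒟.toSpacetime.deviationCk (Minkowski.backgroundOn d.flatDomain) d.flatChart k τ) Filter.atTop (nhds 0)) ∧ (∀ (i : Fin d.N) (k : ℕ) (ρ : ℝ) (ε : ENNReal), 0 < ε → ∀ᶠ τ in Filter.atTop, ∃ M a : ℝ, m₀ ≤ M ∧ M ≤ m₀⁻¹ ∧ |a| ≤ χ * M ∧ 𝒟.toSpacetime.truncDeviationCk ⟨(d.background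 i).domain, boostedKerrBilin (d.motion i).1 (d.motion i).2 M a, (d.background i).time, (d.background i).radius⟩ (d.chart i) k ρ τ ≤ ε ∧ 𝒟.toSpacetime.truncDeviationCk ⟨(d.background i).domain, boostedKerrBilin (d.motion i).1 (d.motion i).2 M a, (d.background i).time, (d.background i).radius⟩ (d.chart i) k (R i τ) τ ≤ ε ∧ ∀ x ∈ (d.background i).truncTimeSlab ρ τ, 𝒟.timeOrientation.IsFutureDirected (mfderiv 𝓘(ℝ, E4) (𝓡 4) (d.chart i) x (((d.motion i).1 : E4 ≃L[ℝ] E4) (Kerr.timeVector M a (poincareInv (d.motion i).1 (d.motion i).2 (x : E4)))))))) 1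

/-- Statement of C₂^∞ (`settlingAllOrdersAlongCensoredKerrEnds`, NOT a stub of the composition — a record): ALL-ORDERS
SETTLING ALONG CENSORED KERR-ENDED CURVES through exceptional base data, in the Statement's vocabulary (every MGHD: complete
`𝓘⁺`, a `C²` final state decomposition of `O = exteriorOf charted` with sub-extremal holes, `RaysStayInClosure`,
`IsFutureOriented`, honest exhaustive radii with causal exhaustion, and convergence in the SAME charts at EVERY order on
flat slabs, fixed and growing near zones) — the all-orders twin of `Theses.ExactKerrEnds.SettlingAlongCensoredKerrEnds`
(stmt-FinalStateConjecture-18520).  `C₂^∞ → C₂'` is the landed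
`Theorems.….alongCensoredKerrEnds_of_settlingAllOrdersAlongCensoredKerrEnds` (p156598). -/
def Sig.settlingAllOrdersAlongCensoredKerrEnds : Prop :=
  open Summit.FinalStateConjecture (IsFutureOriented certifiedLate certifiedSlab) in
  ∀ (X : Type) [TopologicalSpace X] [ChartedSpace E3 X] [IsManifold (𝓡 3) ∞ X] [T2Space X] [SecondCountableTopology X] [ConnectedSpace X], ∀ (e : AFEnd X) (F : EuclideanSpace ℝ (Fin 1) → InitialDataSet (𝓡 3) X), IsTameDataFamily e 1 F → ((IsImmersedAtZero 1 F ∧ Injective F) ∨ ∀ c, F c = F 0) → (∀ c, F c ∈ admissibleVacuumData X) → (∀ c ≠ 0, (F c).HasExactKerrEnd ∧ ∀ 𝒟 : VacuumCauchyDevelopment (F c), 𝒟.IsMaximal → HasCompleteNullInfinity 𝒟.toCauchyDevelopment) → ¬ (∀ 𝒟 : VacuumCauchyDevelopment (F 0), 𝒟.IsMaximal → HasCompleteNullInfinity 𝒟.toCauchyDevelopment ∧ ∃ (O : Set 𝒟.carrier) (d : FinalStateDecomposition 𝒟.toSpacetime O 2), (∀ i, Kerr.IsSubextremal (d.mass i)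 (d.spin i)) ∧ O = exteriorOf 𝒟.toCauchyDevelopment d.charted ∧ RaysStayInClosure 𝒟.toCauchyDevelopment O ∧ IsFutureOriented d ∧ (∀ k, Tendsto (fun τ => 𝒟.toSpacetime.deviationCk (Minkowski.backgroundOn d.flatDomain) d.flatChart k τ) atTop (𝓝 0)) ∧ (∀ i k (ρ : ℝ), Tendsto (fun τ => 𝒟.toSpacetime.truncDeviationCk (d.background i) (d.chart i) k ρ τ) atTop (𝓝 0)) ∧ ∃ R : Fin d.N → ℝ → ℝ, (∀ i, Tendsto (R i) atTop atTop ∧ ∀ τ, max (Kerr.rPlus (d.mass i) (d.spin i)) 0 + 1 ≤ R i τ) ∧ (∀ i k, Tendsto (fun τ => 𝒟.toSpacetime.truncDeviationCk (d.background i) (d.chart i) k (R i τ) τ) atTop (𝓝 0)) ∧ ∀ τ₁, d.τ₀ < τ₁ → O \ certifiedLate d R τ₁ ⊆ 𝒟.metric.causalPast 𝒟.timeOrientation (certifiedSlab d R τ₁)) → ∃ (e' : AFEnd X) (F' : EuclideanSpace ℝ (Fin 1) → InitialDataSet (𝓡 3) X), IsTameDataFamily e' 1 F' ∧ F' 0 =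 F 0 ∧ Injective F' ∧ IsImmersedAtZero 1 F' ∧ (∀ c, F' c ∈ admissibleVacuumData X) ∧ ∀ c ≠ 0, ∀ 𝒟 : VacuumCauchyDevelopment (F' c), 𝒟.IsMaximal → HasCompleteNullInfinity 𝒟.toCauchyDevelopment ∧ ∃ (O : Set 𝒟.carrier) (d : FinalStateDecomposition 𝒟.toSpacetime O 2), (∀ i, Kerr.IsSubextremal (d.mass i) (d.spin i)) ∧ O = exteriorOf 𝒟.toCauchyDevelopment d.charted ∧ RaysStayInClosure 𝒟.toCauchyDevelopment O ∧ IsFutureOriented d ∧ (∀ k, Tendsto (fun τ => 𝒟.toSpacetime.deviationCk (Minkowski.backgroundOn d.flatDomain) d.flatChart k τ) atTop (𝓝 0)) ∧ (∀ i k (ρ : ℝ), Tendsto (fun τ => 𝒟.toSpacetime.truncDeviationCk (d.background i) (d.chart i) k ρ τ) atTop (𝓝 0)) ∧ ∃ R : Fin d.N → ℝ → ℝ, (∀ i, Tendsto (R i) atTop atTop ∧ ∀ τ, max (Kerr.rPlus (d.mass i) (d.spin i)) 0 + 1 ≤ R i τ) ∧ (∀ i k, Tendsto (fun τ => 𝒟.toSpacetime.truncDeviationCk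 (d.background i) (d.chart i) k (R i τ) τ) atTop (𝓝 0)) ∧ ∀ τ₁, d.τ₀ < τ₁ → O \ certifiedLate d R τ₁ ⊆ 𝒟.metric.causalPast 𝒟.timeOrientation (certifiedSlab d R τ₁)

/-! ## Registered stubs (`sorry` only here; signatures def-free and `:=`-free; C₃ is written with the namespace-level
`open`s above and forced binder types elided so that its SOURCE TEXT stays under the registrar's 3900-character cut —
it elaborates to the same term as the fully qualified spelling) -/

/-- **E — KERR-ENDEDNESS IS TAME-GENERIC** (item stmt-FinalStateConjecture-18522 of route `ExactKerrEnds`, BY NAME: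
through every admissible non-Kerr-ended datum passes a tame injective immersed admissible curve whose members off `0`
are Kerr-ended; Corvino–Schoen density run as a tame curve).  Imported: discharged by `exact
Theses.ExactKerrEnds.TameEscapeToKerrEnds_holds` once that item closes.  Why it might fail / sources: see that item
(CorvinoSchoen2006, ChruscielDelay2003, CzimekRodnianski2022).  Size: L (theirs). -/
theorem stub_tameEscapeToKerrEnds : Summit.FinalStateConjecture.FinalStateConjecture.Theses.ExactKerrEnds.TameEscapeToKerrEnds := by
  sorry

/-- **C₁ — CENSORSHIP ALONG KERR-ENDED CURVES** (item stmt-FinalStateConjecture-18521 of route `ExactKerrEnds`, BY NAME: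
along every tame curve of admissible data, immersed-injective or constant, whose members off `0` are Kerr-ended, there
is a tame injective immersed admissible curve through the same base datum whose members off `0` are Kerr-ended AND
censored).  Imported: discharged by `exact Theses.ExactKerrEnds.CensorshipAlongKerrEnds_holds` once that item closes.
Why it might fail: a tame-stably naked smooth Kerr-ended vacuum datum (sources: Christodoulou1999,
RodnianskiShlapentokhRothman2023, DafermosLuk2017).  Size: open-problem (theirs). -/
theorem stub_censorshipAlongKerrEnds : Summit.FinalStateConjecture.FinalStateConjecture.Theses.ExactKerrEnds.CensorshipAlongKerrEnds := by
  sorry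

/-- **C₂ — SETTLING ALONG CENSORED KERR-ENDED CURVES** (item stmt-FinalStateConjecture-18520 of route `ExactKerrEnds`, BY NAME:
along every tame curve of admissible data, immersed-injective or constant, whose members off `0` are Kerr-ended and censored,
there is a tame injective immersed admissible curve through the same base datum whose members off `0` satisfy the Statement's
settled clause for every MGHD — complete `𝓘⁺`, a `C²` final state decomposition of `O = exteriorOf charted` with sub-extremal
holes, `RaysStayInClosure`, `HasExhaustiveCharts`, `IsFutureOriented`).  Imported: discharged by
`exact Theses.ExactKerrEnds.SettlingAlongCensoredKerrEnds_holds` once that item closes (its line: skeleton `wall_cone_sections`,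
glue `settlingAlongCensoredKerrEnds_of_tameCurves` p166695).  Why it might fail: an open set of censored Kerr-ended data with a
non-Kerr ω-limit / eternal binary / tame-stable extremal remnant; rays off `closure O`; non-uniformity as the end recedes
(sources: DafermosLuk2017, KlainermanSzeftel2023, DafermosHolzegelRodnianskiTaylor2021, CorvinoSchoen2006).  Size: open-problem (theirs). -/
theorem stub_settlingAlongCensoredKerrEnds : Summit.FinalStateConjecture.FinalStateConjecture.Theses.ExactKerrEnds.SettlingAlongCensoredKerrEnds := by
  sorry

/-- **C₃ — SUBCONVERGENT ERA ALONG SETTLED CURVES, WINDOW FORM (the residual import of this route since lead c8: an UPGRADE).**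
For every `X`, every end `e` and every tame curve `F` of admissible data on `e`, immersed at `0` and injective, whose members
off `0` are SETTLED in the Statement's vocabulary (every MGHD: complete `𝓘⁺` and a `C²` final state decomposition of
`O = exteriorOf charted` with sub-extremal holes, `RaysStayInClosure`, `HasExhaustiveCharts`, `IsFutureOriented`), and whose
base datum `F 0` is EXCEPTIONAL for the crux's property `P` (every MGHD: complete `𝓘⁺` and an honest subconvergent final era —
`m₀ > 0`, `χ < 1`, `O`, `d : QuasiFinalStateDecomposition 𝒟 O 2 ⊤`, radii `Rᵢ → ∞`, `Rᵢ ≥ max(r₊,0)+1`, `O = exteriorOf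
charted`, `RaysStayInClosure O`, causal exhaustion, orthochronous `Λᵢ`, covector chart-time orientation, flat `∂₀`
future-directed, flat zone `→ η` in EVERY `Cᵏ`, windowed `Cᵏ`-closeness for EVERY `k` on fixed and growing slabs to a
wandering sub-extremal member), there are an end `e'`, a window `ε > 0` and a curve `F'`, tame on `e'` and immersed at `0`,
`F' 0 = F 0`, whose members with `‖c‖ < ε` are admissible and whose members with `0 < ‖c‖ < ε` satisfy `P` (no injectivity, no
control outside the window: both are free, `isTameChristodoulouGeneric_one_of_localWindow`).  Its order-`2` cut is PROVED below
(`alongSettledWindowUpToTwo`, `F' = F`), so its content is exactly the orders `k ≥ 3` of the two convergence clauses.  Why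
plausibly true: for tame-tailed (e.g. Kerr-ended) settled members the stability mechanism (commuted energy estimates) delivers
every derivative, and rough-tailed members can be re-glued far out to exact Kerr along a receding, tame-legal modification; it is
NECESSARY for the crux (`crux → C₃`).  Why it might fail: only with the crux itself; mechanism-wise the re-glued members must
re-settle (Kerr-stability-type input over the full sub-extremal range), and `F' = F` fails for `o₂` tails focusing at order `3`.
Sources: DafermosLuk2017, KlainermanSzeftel2023, arXiv:2606.28253 (Hintz 2026), DafermosHolzegelRodnianskiTaylor2021,
CorvinoSchoen2006, Christodoulou1999.  Size: open-problem (import), strictly inside C₂ʷ modulo C₂. -/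
theorem stub_subconvergentEraAlongSettledWindow : ∀ (X : Type) [TopologicalSpace X] [ChartedSpace E3 X] [IsManifold (𝓡 3) ∞ X] [T2Space X] [SecondCountableTopology X] [ConnectedSpace X], ∀ D, ¬ (∀ 𝒟 : VacuumCauchyDevelopment D, 𝒟.IsMaximal → HasCompleteNullInfinity 𝒟.toCauchyDevelopment ∧ (∃ (m₀ χ : ℝ) (O : Set 𝒟.carrier) (d : QuasiFinalStateDecomposition 𝒟.toSpacetime O 2 ⊤) (R : Fin d.N → ℝ → ℝ), 0 < m₀ ∧ χ < 1 ∧ O = exteriorOf 𝒟.toCauchyDevelopment d.charted ∧ RaysStayInClosure 𝒟.toCauchyDevelopment O ∧ (∀ i, Tendsto (R i) atTop atTop ∧ ∀ τ, max (Kerr.rPlus (d.mass i) (d.spin i)) 0 + 1 ≤ R i τ) ∧ (∀ τ₁, d.τ₀ < τ₁ → O \ d.certifiedLate R τ₁ ⊆ 𝒟.metric.causalPast 𝒟.timeOrientation (d.certifiedSlab R τ₁)) ∧ (∀ i, IsOrthochronous (d.motion i).1) ∧ (∀ i (ρ : ℝ), ∀ᶠ τ in atTop, ∀ x ∈ (d.background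 i).truncTimeSlab ρ τ, ∀ w : E4, 𝒟.timeOrientation.IsFutureDirected (mfderiv 𝓘(ℝ, E4) (𝓡 4) (d.chart i) x w) → 0 < ((d.motion i).1 : E4 ≃L[ℝ] E4).symm w 0) ∧ (∀ᶠ τ in atTop, ∀ x ∈ (Minkowski.backgroundOn d.flatDomain).timeSlab τ, 𝒟.timeOrientation.IsFutureDirected (mfderiv 𝓘(ℝ, E4) (𝓡 4) d.flatChart x (E4.basisVector 0))) ∧ (∀ k, Tendsto (fun τ => 𝒟.toSpacetime.deviationCk (Minkowski.backgroundOn d.flatDomain) d.flatChart k τ) atTop (𝓝 0)) ∧ (∀ i k (ρ : ℝ) (ε : ℝ≥0∞), 0 < ε → ∀ᶠ τ in atTop, ∃ M a, m₀ ≤ M ∧ M ≤ m₀⁻¹ ∧ |a| ≤ χ * M ∧ 𝒟.toSpacetime.truncDeviationCk ⟨(d.background i).domain, boostedKerrBilin (d.motion i).1 (d.motion i).2 M a, (d.background i).time, (d.background i).radius⟩ (d.chart i) k ρ τ ≤ ε ∧ 𝒟.toSpacetime.truncDeviationCk ⟨(d.background i).domain, boostedKerrBilin (d.motion i).1 (d.motion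 i).2 M a, (d.background i).time, (d.background i).radius⟩ (d.chart i) k (R i τ) τ ≤ ε))) → ∀ e F, IsTameDataFamily e 1 F → IsImmersedAtZero 1 F → Injective F → F 0 = D → (∀ c, F c ∈ admissibleVacuumData X) → (∀ c ≠ 0, ∀ 𝒟 : VacuumCauchyDevelopment (F c), 𝒟.IsMaximal → HasCompleteNullInfinity 𝒟.toCauchyDevelopment ∧ ∃ (O : _) (d : FinalStateDecomposition 𝒟.toSpacetime O 2), (∀ i, Kerr.IsSubextremal (d.mass i) (d.spin i)) ∧ O = exteriorOf 𝒟.toCauchyDevelopment d.charted ∧ RaysStayInClosure 𝒟.toCauchyDevelopment O ∧ HasExhaustiveCharts d ∧ IsFutureOriented d) → ∃ e' ε F', 0 < ε ∧ IsTameDataFamily e' 1 F' ∧ IsImmersedAtZero 1 F' ∧ F' 0 = D ∧ (∀ c, ‖c‖ < ε → F' c ∈ admissibleVacuumData X) ∧ ∀ c, c ≠ 0 → ‖c‖ < ε → ∀ 𝒟 : VacuumCauchyDevelopment (F' c), 𝒟.IsMaximal → HasCompleteNullInfinity 𝒟.toCauchyDevelopment ∧ (∃ (m₀ χ : ℝ)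 (O : Set 𝒟.carrier) (d : QuasiFinalStateDecomposition 𝒟.toSpacetime O 2 ⊤) (R : Fin d.N → ℝ → ℝ), 0 < m₀ ∧ χ < 1 ∧ O = exteriorOf 𝒟.toCauchyDevelopment d.charted ∧ RaysStayInClosure 𝒟.toCauchyDevelopment O ∧ (∀ i, Tendsto (R i) atTop atTop ∧ ∀ τ, max (Kerr.rPlus (d.mass i) (d.spin i)) 0 + 1 ≤ R i τ) ∧ (∀ τ₁, d.τ₀ < τ₁ → O \ d.certifiedLate R τ₁ ⊆ 𝒟.metric.causalPast 𝒟.timeOrientation (d.certifiedSlab R τ₁)) ∧ (∀ i, IsOrthochronous (d.motion i).1) ∧ (∀ i (ρ : ℝ), ∀ᶠ τ in atTop, ∀ x ∈ (d.background i).truncTimeSlab ρ τ, ∀ w : E4, 𝒟.timeOrientation.IsFutureDirected (mfderiv 𝓘(ℝ, E4) (𝓡 4) (d.chart i) x w) → 0 < ((d.motion i).1 : E4 ≃L[ℝ] E4).symm w 0) ∧ (∀ᶠ τ in atTop, ∀ x ∈ (Minkowski.backgroundOn d.flatDomain).timeSlab τ, 𝒟.timeOrientation.IsFutureDirected (mfderiv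 𝓘(ℝ, E4) (𝓡 4) d.flatChart x (E4.basisVector 0))) ∧ (∀ k, Tendsto (fun τ => 𝒟.toSpacetime.deviationCk (Minkowski.backgroundOn d.flatDomain) d.flatChart k τ) atTop (𝓝 0)) ∧ (∀ i k (ρ : ℝ) (ε : ℝ≥0∞), 0 < ε → ∀ᶠ τ in atTop, ∃ M a, m₀ ≤ M ∧ M ≤ m₀⁻¹ ∧ |a| ≤ χ * M ∧ 𝒟.toSpacetime.truncDeviationCk ⟨(d.background i).domain, boostedKerrBilin (d.motion i).1 (d.motion i).2 M a, (d.background i).time, (d.background i).radius⟩ (d.chart i) k ρ τ ≤ ε ∧ 𝒟.toSpacetime.truncDeviationCk ⟨(d.background i).domain, boostedKerrBilin (d.motion i).1 (d.motion i).2 M a, (d.background i).time, (d.background i).radius⟩ (d.chart i) k (R i τ) τ ≤ ε)) := by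
  sorry

/-! ## Composition: the crux BY NAME from the four stubs (real proof, no `sorry`; C₂ ∧ C₃ ⇒ C₂ʷ inlined, then the landed window composition p166919, IMPORTED) -/

open Summit.FinalStateConjecture.FinalStateConjecture.Theorems.LogTimeThreeAnnuli.SubconvergentEraGeneric
  (exists_censoredKerrEndedCurve subconvergentEraGeneric_of_alongCensoredKerrEndsWindow
    alongCensoredKerrEnds_of_subconvergentEraGeneric subconvergentEraGeneric_of_censoredOmegaLimitGeneric
    alongCensoredKerrEnds_of_settlingAllOrdersAlongCensoredKerrEnds subconvergentEraGeneric_iff_localWindow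
    alongCensoredKerrEndsWindow_of_localWindow subconvergentEraUpToTwo_of_settled)

/-- **C₂ ∧ C₃ ⇒ C₂ʷ** (= `Theorems.….alongCensoredKerrEndsWindow_of_settling_of_alongSettledWindow` of the c8 record file,
inlined): hand the censored Kerr-ended incoming curve of C₂ʷ to C₂ (immersed-injective branch), transport exceptionality of
the common base datum, and give the settled curve to C₃. -/
theorem alongCensoredKerrEndsWindow_of_settling_of_alongSettledWindow :
    Sig.stub_settlingAlongCensoredKerrEnds → Sig.stub_subconvergentEraAlongSettledWindow →
      Sig.stub_subconvergentEraAlongCensoredKerrEndsWindow := by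
  intro hS hU X _ _ _ _ _ _ e F hF himm hinj hadm hQ hnP
  obtain ⟨e₂, F₂, hF₂, h0₂, hinj₂, himm₂, hadm₂, hS₂⟩ := hS X e F hF (Or.inl ⟨himm, hinj⟩) hadm hQ
  exact hU X (F 0) hnP e₂ F₂ hF₂ himm₂ hinj₂ h0₂ hadm₂ hS₂

/-- **SubconvergentEraGeneric from E, C₁, C₂, C₃**: C₂ ∧ C₃ give C₂ʷ (above); then the landed window composition
(`Theorems.….subconvergentEraGeneric_of_alongCensoredKerrEndsWindow`, p166919, imported): at an admissible datum exceptional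
for `P`, the genuine censored Kerr-ended curve of `exists_censoredKerrEndedCurve` (E ∧ C₁ pointed) is handed to C₂ʷ and the
window-controlled `P`-curve to `isTameChristodoulouGeneric_one_of_localWindow` — which is the route decl, by name. -/
theorem SubconvergentEraGeneric_of :
    Sig.stub_tameEscapeToKerrEnds → Sig.stub_censorshipAlongKerrEnds → Sig.stub_settlingAlongCensoredKerrEnds →
      Sig.stub_subconvergentEraAlongSettledWindow → SubconvergentEraGeneric :=
  fun hE hC hS hU => subconvergentEraGeneric_of_alongCensoredKerrEndsWindow hE hC
    (alongCensoredKerrEndsWindow_of_settling_of_alongSettledWindow hS hU)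

/-- The crux by name, closed modulo the four registered stubs (three of them existing items by name). -/
theorem subconvergentEraGeneric_of_stubs : SubconvergentEraGeneric :=
  SubconvergentEraGeneric_of stub_tameEscapeToKerrEnds stub_censorshipAlongKerrEnds stub_settlingAlongCensoredKerrEnds
    stub_subconvergentEraAlongSettledWindow

/-! ## Records: C₃ and C₂ʷ are NECESSARY for the crux (so the residuals are not junk-stronger); C₂' / K_ret / C₂^∞ ⇒ C₂ʷ; C₃ cut at order 2 is a theorem; FSC ⇒ crux≤₂ -/

/-- **The reshape only weakens: C₂' ⇒ C₂ʷ** (= `Theorems.….alongCensoredKerrEndsWindow_of_alongCensoredKerrEnds`,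
p166919): a genuine incoming curve is in particular "immersed-injective or constant", and a globally controlled output
curve is window-controlled on `‖c‖ < 1`. -/
theorem alongCensoredKerrEndsWindow_of_alongCensoredKerrEnds :
    Sig.stub_subconvergentEraAlongCensoredKerrEnds_retired → Sig.stub_subconvergentEraAlongCensoredKerrEndsWindow := by
  intro hS X _ _ _ _ _ _ e F hF himm hinj hadm hQ hnP
  obtain ⟨e', F', hF', h0', -, himm', hadm', hP'⟩ := hS X e F hF (Or.inl ⟨himm, hinj⟩) hadm hQ hnP
  exact ⟨e', 1, F', one_pos, hF', himm', h0', fun c _ => hadm' c, fun c hc _ => hP' c hc⟩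

/-- **The crux implies C₂ʷ** unconditionally (landed `crux → C₂'`, p154553, then `C₂' → C₂ʷ`).  Hence, given E
and C₁, the crux and C₂ʷ are EQUIVALENT: the reshape loses nothing and adds nothing. -/
theorem alongCensoredKerrEndsWindow_of_subconvergentEraGeneric :
    SubconvergentEraGeneric → Sig.stub_subconvergentEraAlongCensoredKerrEndsWindow :=
  fun h => alongCensoredKerrEndsWindow_of_alongCensoredKerrEnds (alongCensoredKerrEnds_of_subconvergentEraGeneric h)

/-- **Given E and C₁, the crux is equivalent to C₂ʷ.** -/
theorem subconvergentEraGeneric_iff_alongCensoredKerrEndsWindow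
    (hE : Sig.stub_tameEscapeToKerrEnds) (hC : Sig.stub_censorshipAlongKerrEnds) :
    SubconvergentEraGeneric ↔ Sig.stub_subconvergentEraAlongCensoredKerrEndsWindow :=
  ⟨alongCensoredKerrEndsWindow_of_subconvergentEraGeneric, subconvergentEraGeneric_of_alongCensoredKerrEndsWindow hE hC⟩

/-- **The crux implies C₃** unconditionally: forget the incoming settled curve and read the crux in its bare window form
(`subconvergentEraGeneric_iff_localWindow`, p167205) at the base datum.  So the new residual is not junk-stronger. -/
theorem alongSettledWindow_of_subconvergentEraGeneric :
    SubconvergentEraGeneric → Sig.stub_subconvergentEraAlongSettledWindow := by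
  intro h X _ _ _ _ _ _ D hnP e F _ _ _ h0 hadm _
  exact (subconvergentEraGeneric_iff_localWindow.mp h) X D (h0 ▸ hadm 0) hnP

/-- **Given E, C₁ and C₂, the crux is equivalent to C₃.** -/
theorem subconvergentEraGeneric_iff_alongSettledWindow (hE : Sig.stub_tameEscapeToKerrEnds)
    (hC : Sig.stub_censorshipAlongKerrEnds) (hS : Sig.stub_settlingAlongCensoredKerrEnds) :
    SubconvergentEraGeneric ↔ Sig.stub_subconvergentEraAlongSettledWindow :=
  ⟨alongSettledWindow_of_subconvergentEraGeneric, SubconvergentEraGeneric_of hE hC hS⟩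

/-- **C₃ CUT AT ORDER 2 IS A THEOREM.**  With `P` replaced by its order-`2` cut (both `∀ k` clauses restricted to `k ≤ 2`) in
hypothesis and conclusion, the incoming settled curve itself is the witness (`F' = F`, `ε = 1`): a member satisfying the
Statement's settled clause carries the cut era (`subconvergentEraUpToTwo_of_settled` = c4's `era_upTo_of_settled` at `k₀ = 2`,
p172199).  Hence the content of C₃ is exactly the orders `k ≥ 3`. -/
theorem alongSettledWindowUpToTwo : ∀ (X : Type) [TopologicalSpace X] [ChartedSpace E3 X] [IsManifold (𝓡 3) ∞ X] [T2Space X] [SecondCountableTopology X] [ConnectedSpace X], ∀ D, ¬ (∀ 𝒟 : VacuumCauchyDevelopment D, 𝒟.IsMaximal → HasCompleteNullInfinity 𝒟.toCauchyDevelopment ∧ (∃ (m₀ χ : ℝ) (O : Set 𝒟.carrier) (d : QuasiFinalStateDecomposition 𝒟.toSpacetime O 2 ⊤) (R : Fin d.N → ℝ → ℝ), 0 < m₀ ∧ χ < 1 ∧ O = exteriorOf 𝒟.toCauchyDevelopment d.charted ∧ RaysStayInClosure 𝒟.toCauchyDevelopment O ∧ (∀ i, Tendsto (R i) atTop atTop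 ∧ ∀ τ, max (Kerr.rPlus (d.mass i) (d.spin i)) 0 + 1 ≤ R i τ) ∧ (∀ τ₁, d.τ₀ < τ₁ → O \ d.certifiedLate R τ₁ ⊆ 𝒟.metric.causalPast 𝒟.timeOrientation (d.certifiedSlab R τ₁)) ∧ (∀ i, IsOrthochronous (d.motion i).1) ∧ (∀ i (ρ : ℝ), ∀ᶠ τ in atTop, ∀ x ∈ (d.background i).truncTimeSlab ρ τ, ∀ w : E4, 𝒟.timeOrientation.IsFutureDirected (mfderiv 𝓘(ℝ, E4) (𝓡 4) (d.chart i) x w) → 0 < ((d.motion i).1 : E4 ≃L[ℝ] E4).symm w 0) ∧ (∀ᶠ τ in atTop, ∀ x ∈ (Minkowski.backgroundOn d.flatDomain).timeSlab τ, 𝒟.timeOrientation.IsFutureDirected (mfderiv 𝓘(ℝ, E4) (𝓡 4) d.flatChart x (E4.basisVector 0))) ∧ (∀ k ≤ 2, Tendsto (fun τ => 𝒟.toSpacetime.deviationCk (Minkowski.backgroundOn d.flatDomain) d.flatChart k τ) atTop (𝓝 0)) ∧ (∀ i, ∀ k ≤ 2, ∀ (ρ : ℝ) (ε : ℝ≥0∞),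 0 < ε → ∀ᶠ τ in atTop, ∃ M a, m₀ ≤ M ∧ M ≤ m₀⁻¹ ∧ |a| ≤ χ * M ∧ 𝒟.toSpacetime.truncDeviationCk ⟨(d.background i).domain, boostedKerrBilin (d.motion i).1 (d.motion i).2 M a, (d.background i).time, (d.background i).radius⟩ (d.chart i) k ρ τ ≤ ε ∧ 𝒟.toSpacetime.truncDeviationCk ⟨(d.background i).domain, boostedKerrBilin (d.motion i).1 (d.motion i).2 M a, (d.background i).time, (d.background i).radius⟩ (d.chart i) k (R i τ) τ ≤ ε))) → ∀ e F, IsTameDataFamily e 1 F → IsImmersedAtZero 1 F → Injective F → F 0 = D → (∀ c, F c ∈ admissibleVacuumData X) → (∀ c ≠ 0, ∀ 𝒟 : VacuumCauchyDevelopment (F c), 𝒟.IsMaximal → HasCompleteNullInfinity 𝒟.toCauchyDevelopment ∧ ∃ (O : _) (d : FinalStateDecomposition 𝒟.toSpacetime O 2), (∀ i, Kerr.IsSubextremal (d.mass i) (d.spin i)) ∧ O = exteriorOf 𝒟.toCauchyDevelopment d.charted ∧ RaysStayInClosure 𝒟.toCauchyDevelopment O ∧ HasExhaustiveCharts d ∧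 IsFutureOriented d) → ∃ e' ε F', 0 < ε ∧ IsTameDataFamily e' 1 F' ∧ IsImmersedAtZero 1 F' ∧ F' 0 = D ∧ (∀ c, ‖c‖ < ε → F' c ∈ admissibleVacuumData X) ∧ ∀ c, c ≠ 0 → ‖c‖ < ε → ∀ 𝒟 : VacuumCauchyDevelopment (F' c), 𝒟.IsMaximal → HasCompleteNullInfinity 𝒟.toCauchyDevelopment ∧ (∃ (m₀ χ : ℝ) (O : Set 𝒟.carrier) (d : QuasiFinalStateDecomposition 𝒟.toSpacetime O 2 ⊤) (R : Fin d.N → ℝ → ℝ), 0 < m₀ ∧ χ < 1 ∧ O = exteriorOf 𝒟.toCauchyDevelopment d.charted ∧ RaysStayInClosure 𝒟.toCauchyDevelopment O ∧ (∀ i, Tendsto (R i) atTop atTop ∧ ∀ τ, max (Kerr.rPlus (d.mass i) (d.spin i)) 0 + 1 ≤ R i τ) ∧ (∀ τ₁, d.τ₀ < τ₁ → O \ d.certifiedLate R τ₁ ⊆ 𝒟.metric.causalPast 𝒟.timeOrientation (d.certifiedSlab R τ₁)) ∧ (∀ i, IsOrthochronous (d.motion i).1) ∧ (∀ i (ρ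 : ℝ), ∀ᶠ τ in atTop, ∀ x ∈ (d.background i).truncTimeSlab ρ τ, ∀ w : E4, 𝒟.timeOrientation.IsFutureDirected (mfderiv 𝓘(ℝ, E4) (𝓡 4) (d.chart i) x w) → 0 < ((d.motion i).1 : E4 ≃L[ℝ] E4).symm w 0) ∧ (∀ᶠ τ in atTop, ∀ x ∈ (Minkowski.backgroundOn d.flatDomain).timeSlab τ, 𝒟.timeOrientation.IsFutureDirected (mfderiv 𝓘(ℝ, E4) (𝓡 4) d.flatChart x (E4.basisVector 0))) ∧ (∀ k ≤ 2, Tendsto (fun τ => 𝒟.toSpacetime.deviationCk (Minkowski.backgroundOn d.flatDomain) d.flatChart k τ) atTop (𝓝 0)) ∧ (∀ i, ∀ k ≤ 2, ∀ (ρ : ℝ) (ε : ℝ≥0∞), 0 < ε → ∀ᶠ τ in atTop, ∃ M a, m₀ ≤ M ∧ M ≤ m₀⁻¹ ∧ |a| ≤ χ * M ∧ 𝒟.toSpacetime.truncDeviationCk ⟨(d.background i).domain, boostedKerrBilin (d.motion i).1 (d.motion i).2 M a, (d.background i).time, (d.background i).radius⟩ (d.chart i) k ρ τ ≤ ε ∧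 𝒟.toSpacetime.truncDeviationCk ⟨(d.background i).domain, boostedKerrBilin (d.motion i).1 (d.motion i).2 M a, (d.background i).time, (d.background i).radius⟩ (d.chart i) k (R i τ) τ ≤ ε)) := by
  intro X _ _ _ _ _ _ D _ e F hF himm _ h0 hadm hS
  exact ⟨e, 1, F, one_pos, hF, himm, h0, fun c _ => hadm c, fun c hc _ => subconvergentEraUpToTwo_of_settled (hS c hc)⟩

/-- **NECESSITY DOOR AT ORDER 2: `FinalStateConjecture → crux≤₂`.**  Tame genericity is monotone in the property
(`IsTameChristodoulouGeneric.mono`) and the Statement's property implies the cut property pointwise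
(`subconvergentEraUpToTwo_of_settled`).  With the option-C door (p172199: E → C₁ → C₂ → crux≤₂) and the route's assembly, the
order-`2` restatement of the crux is an honest NECESSARY node of the summit; the crux as filed exceeds it exactly by C₃. -/
theorem subconvergentEraGenericUpToTwo_of_finalStateConjecture : FinalStateConjecture → ∀ (X : Type) [TopologicalSpace X] [ChartedSpace E3 X] [IsManifold (𝓡 3) ∞ X] [T2Space X] [SecondCountableTopology X] [ConnectedSpace X], IsTameChristodoulouGeneric (admissibleVacuumData X) (fun D => ∀ 𝒟 : VacuumCauchyDevelopment D, 𝒟.IsMaximal → HasCompleteNullInfinity 𝒟.toCauchyDevelopment ∧ (∃ (m₀ χ : ℝ) (O : Set 𝒟.carrier) (d : QuasiFinalStateDecomposition 𝒟.toSpacetime O 2 ⊤) (R : Fin d.N → ℝ → ℝ), 0 < m₀ ∧ χ < 1 ∧ O = exteriorOf 𝒟.toCauchyDevelopment d.charted ∧ RaysStayInClosure 𝒟.toCauchyDevelopment O ∧ (∀ i, Tendsto (R i) atTop atTop ∧ ∀ τ, max (Kerr.rPlus (d.mass i) (d.spin i)) 0 + 1 ≤ R i τ) ∧ (∀ τ₁,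 d.τ₀ < τ₁ → O \ d.certifiedLate R τ₁ ⊆ 𝒟.metric.causalPast 𝒟.timeOrientation (d.certifiedSlab R τ₁)) ∧ (∀ i, IsOrthochronous (d.motion i).1) ∧ (∀ i (ρ : ℝ), ∀ᶠ τ in atTop, ∀ x ∈ (d.background i).truncTimeSlab ρ τ, ∀ w : E4, 𝒟.timeOrientation.IsFutureDirected (mfderiv 𝓘(ℝ, E4) (𝓡 4) (d.chart i) x w) → 0 < ((d.motion i).1 : E4 ≃L[ℝ] E4).symm w 0) ∧ (∀ᶠ τ in atTop, ∀ x ∈ (Minkowski.backgroundOn d.flatDomain).timeSlab τ, 𝒟.timeOrientation.IsFutureDirected (mfderiv 𝓘(ℝ, E4) (𝓡 4) d.flatChart x (E4.basisVector 0))) ∧ (∀ k ≤ 2, Tendsto (fun τ => 𝒟.toSpacetime.deviationCk (Minkowski.backgroundOn d.flatDomain) d.flatChart k τ) atTop (𝓝 0)) ∧ (∀ i, ∀ k ≤ 2, ∀ (ρ : ℝ) (ε : ℝ≥0∞), 0 < ε → ∀ᶠ τ in atTop, ∃ M a, m₀ ≤ M ∧ M ≤ m₀⁻¹ ∧ |a|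 ≤ χ * M ∧ 𝒟.toSpacetime.truncDeviationCk ⟨(d.background i).domain, boostedKerrBilin (d.motion i).1 (d.motion i).2 M a, (d.background i).time, (d.background i).radius⟩ (d.chart i) k ρ τ ≤ ε ∧ 𝒟.toSpacetime.truncDeviationCk ⟨(d.background i).domain, boostedKerrBilin (d.motion i).1 (d.motion i).2 M a, (d.background i).time, (d.background i).radius⟩ (d.chart i) k (R i τ) τ ≤ ε))) 1 := by
  intro h X _ _ _ _ _ _
  exact (h X).mono fun D _ hP => subconvergentEraUpToTwo_of_settled hP.2

/-- K (retired, vector gauge) ⇒ C₂ʷ: through the landed reductions `K → crux` (p150909) and `crux → C₂ʷ`. -/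
theorem alongCensoredKerrEndsWindow_of_retiredK :
    Sig.stub_censoredOmegaLimitGeneric_retired → Sig.stub_subconvergentEraAlongCensoredKerrEndsWindow :=
  fun hK => alongCensoredKerrEndsWindow_of_subconvergentEraGeneric (subconvergentEraGeneric_of_censoredOmegaLimitGeneric hK)

/-- **C₂^∞ ⇒ C₂ʷ**: all-orders settling along censored Kerr-ended curves (Statement vocabulary, convergent, vector
orientation) hands back the crux's era-curves — the landed pointwise adapter `era_of_settledAllOrders` (p156598) gives
`C₂^∞ → C₂'`, then `C₂' → C₂ʷ`.  So any producer shaped like an all-orders Kerr-settling theorem for data near an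
exceptional datum along censored Kerr-ended curves feeds this line's residual stub. -/
theorem alongCensoredKerrEndsWindow_of_settlingAllOrdersAlong :
    Sig.settlingAllOrdersAlongCensoredKerrEnds → Sig.stub_subconvergentEraAlongCensoredKerrEndsWindow :=
  fun h => alongCensoredKerrEndsWindow_of_alongCensoredKerrEnds
    (alongCensoredKerrEnds_of_settlingAllOrdersAlongCensoredKerrEnds h)

/-- **The crux in its barest shape** (= `Theorems.….subconvergentEraGeneric_iff_localWindow`, p167205, imported): the crux
is EQUIVALENT, unconditionally, to its own window form with NO incoming curve — through every `P`-exceptional admissible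
datum: an end, a window `ε > 0` and a tame curve immersed at `0`, admissible on the window, `P` on the punctured window.
C₂ʷ is this right-hand side asked only where E ∧ C₁ supply a censored Kerr-ended incoming curve (raw material, not an
obligation removed). -/
theorem subconvergentEraGeneric_iff_bareWindow :
    SubconvergentEraGeneric ↔ (∀ (X : Type) [TopologicalSpace X] [ChartedSpace E3 X] [IsManifold (𝓡 3) ∞ X] [T2Space X] [SecondCountableTopology X] [ConnectedSpace X], ∀ D ∈ admissibleVacuumData X, ¬ (∀ 𝒟 : VacuumCauchyDevelopment D, 𝒟.IsMaximal → HasCompleteNullInfinity 𝒟.toCauchyDevelopment ∧ (∃ (m₀ χ : ℝ) (O : Set 𝒟.carrier) (d : QuasiFinalStateDecomposition 𝒟.toSpacetime O 2 ⊤) (R : Fin d.N → ℝ → ℝ), 0 < m₀ ∧ χ < 1 ∧ O = exteriorOf 𝒟.toCauchyDevelopment d.charted ∧ RaysStayInClosure 𝒟.toCauchyDevelopment O ∧ (∀ i, Tendsto (R i) atTop atTop ∧ ∀ τ, max (Kerr.rPlus (d.mass i) (d.spin i)) 0 + 1 ≤ R i τ) ∧ (∀ τ₁, d.τ₀ < τ₁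 → O \ d.certifiedLate R τ₁ ⊆ 𝒟.metric.causalPast 𝒟.timeOrientation (d.certifiedSlab R τ₁)) ∧ (∀ i, IsOrthochronous (d.motion i).1) ∧ (∀ i (ρ : ℝ), ∀ᶠ τ in atTop, ∀ x ∈ (d.background i).truncTimeSlab ρ τ, ∀ w : E4, 𝒟.timeOrientation.IsFutureDirected (mfderiv 𝓘(ℝ, E4) (𝓡 4) (d.chart i) x w) → 0 < ((d.motion i).1 : E4 ≃L[ℝ] E4).symm w 0) ∧ (∀ᶠ τ in atTop, ∀ x ∈ (Minkowski.backgroundOn d.flatDomain).timeSlab τ, 𝒟.timeOrientation.IsFutureDirected (mfderiv 𝓘(ℝ, E4) (𝓡 4) d.flatChart x (E4.basisVector 0))) ∧ (∀ k, Tendsto (fun τ => 𝒟.toSpacetime.deviationCk (Minkowski.backgroundOn d.flatDomain) d.flatChart k τ) atTop (𝓝 0)) ∧ (∀ i k (ρ : ℝ) (ε : ℝ≥0∞), 0 < ε → ∀ᶠ τ in atTop, ∃ M a, m₀ ≤ M ∧ M ≤ m₀⁻¹ ∧ |a| ≤ χ * M ∧ 𝒟.toSpacetime.truncDeviationCk ⟨(d.background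 i).domain, boostedKerrBilin (d.motion i).1 (d.motion i).2 M a, (d.background i).time, (d.background i).radius⟩ (d.chart i) k ρ τ ≤ ε ∧ 𝒟.toSpacetime.truncDeviationCk ⟨(d.background i).domain, boostedKerrBilin (d.motion i).1 (d.motion i).2 M a, (d.background i).time, (d.background i).radius⟩ (d.chart i) k (R i τ) τ ≤ ε))) → ∃ (e' : AFEnd X) (ε : ℝ) (F' : EuclideanSpace ℝ (Fin 1) → InitialDataSet (𝓡 3) X), 0 < ε ∧ IsTameDataFamily e' 1 F' ∧ IsImmersedAtZero 1 F' ∧ F' 0 = D ∧ (∀ c, ‖c‖ < ε → F' c ∈ admissibleVacuumData X) ∧ ∀ c, c ≠ 0 → ‖c‖ < ε → ∀ 𝒟 : VacuumCauchyDevelopment (F' c), 𝒟.IsMaximal → HasCompleteNullInfinity 𝒟.toCauchyDevelopment ∧ (∃ (m₀ χ : ℝ) (O : Set 𝒟.carrier) (d : QuasiFinalStateDecomposition 𝒟.toSpacetime O 2 ⊤) (R : Fin d.N → ℝ → ℝ), 0 < m₀ ∧ χ < 1 ∧ O = exteriorOf 𝒟.toCauchyDevelopment d.charted ∧ RaysStayInClosure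 𝒟.toCauchyDevelopment O ∧ (∀ i, Tendsto (R i) atTop atTop ∧ ∀ τ, max (Kerr.rPlus (d.mass i) (d.spin i)) 0 + 1 ≤ R i τ) ∧ (∀ τ₁, d.τ₀ < τ₁ → O \ d.certifiedLate R τ₁ ⊆ 𝒟.metric.causalPast 𝒟.timeOrientation (d.certifiedSlab R τ₁)) ∧ (∀ i, IsOrthochronous (d.motion i).1) ∧ (∀ i (ρ : ℝ), ∀ᶠ τ in atTop, ∀ x ∈ (d.background i).truncTimeSlab ρ τ, ∀ w : E4, 𝒟.timeOrientation.IsFutureDirected (mfderiv 𝓘(ℝ, E4) (𝓡 4) (d.chart i) x w) → 0 < ((d.motion i).1 : E4 ≃L[ℝ] E4).symm w 0) ∧ (∀ᶠ τ in atTop, ∀ x ∈ (Minkowski.backgroundOn d.flatDomain).timeSlab τ, 𝒟.timeOrientation.IsFutureDirected (mfderiv 𝓘(ℝ, E4) (𝓡 4) d.flatChart x (E4.basisVector 0))) ∧ (∀ k, Tendsto (fun τ => 𝒟.toSpacetime.deviationCk (Minkowski.backgroundOn d.flatDomain) d.flatChart k τ) atTop (𝓝 0)) ∧ (∀ i k (ρ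 : ℝ) (ε : ℝ≥0∞), 0 < ε → ∀ᶠ τ in atTop, ∃ M a, m₀ ≤ M ∧ M ≤ m₀⁻¹ ∧ |a| ≤ χ * M ∧ 𝒟.toSpacetime.truncDeviationCk ⟨(d.background i).domain, boostedKerrBilin (d.motion i).1 (d.motion i).2 M a, (d.background i).time, (d.background i).radius⟩ (d.chart i) k ρ τ ≤ ε ∧ 𝒟.toSpacetime.truncDeviationCk ⟨(d.background i).domain, boostedKerrBilin (d.motion i).1 (d.motion i).2 M a, (d.background i).time, (d.background i).radius⟩ (d.chart i) k (R i τ) τ ≤ ε))) :=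
  subconvergentEraGeneric_iff_localWindow

end Summit.FinalStateConjecture.FinalStateConjecture.Cruxes.SubconvergentEraGeneric.Birth

end
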